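import Summits.HubbardSuperconductivity.HubbardSuperconductivity.Theses.AposterioriCapRg
import Literature.MathematicalPhysics.QuantumLattice.DWaveOrderParameterProofs
import Literature.MathematicalPhysics.QuantumLattice.TorusCooperSum

/-!
# Disproof of `AposterioriOrderCriterionR` — findings (cdisprove, cycles 1–2, 2026-08-16)

Crux (stmt-HubbardSuperconductivity-13884, route AposterioriCapRg, rank 5):

  `∃ kStar etaStar : ℚ, 0 < kStar ∧ 0 < etaStar ∧ ∀ U μ h₀ (D : HubbardScaleData), 0 < h₀ →`
  `  (∀ h ∈ Ioc 0 h₀, ∃ L₀, D.IsCertifiedEnclosure (hubbardScaleReportCT U μ D h) L₀) →`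
  `  D.MeetsThresholds kStar etaStar → (D.meanFieldDensity.fst : ℝ)/2 ≤ dWaveOrderParameter U μ`.

VERDICT AFTER CYCLE 2: **no kill; the crux is decided exactly by the HONESTY of `hubbardScaleReportCT` in
its `m₀` coordinate (§2b), which the tree can evaluate only where it is honest (U = 0, §3; the empty-shell
sub-report at every `U`, §6).**  Everything below is kernel-checked (no `sorry` outside §5); prose only in
docstrings.  New in cycle 2: §2b, §6, §7, §8.

## What a refutation must look like (sharpened in cycle 2)

By §2b (`rWithReport_of_honest`), R — with ANY thresholds — follows from the pointwise-in-`h` bound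
"every tuple reported at `(U, μ, h, L+1, β ≥ β₁)` has `m₀ ≤ c · dWaveSourceDensity (L+1) U μ h + ε`" with a
constant `c ≤ 2`.  So `¬R` needs a point `(U, μ)` and frames in which the CT report is DISHONEST BY A FACTOR
`> 2`, UNIFORMLY in `h → 0⁺` (the datum is `h`-uniform), while keeping `η ≤ etaStar`, `(kStar Λ₀)² ≤ ρ_s κ`.
Where can that happen?
* NOT at `U = 0` (§3: `f_MF` is frame- and `Λ₀`-independent there, `m₀` = free BdG density `→ 0`).
* NOT through the EMPTY-SHELL frames of §6 (constant admissible frames `K ≡ -(μ+4+Λ₀)`, available for every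
  `μ ∈ [-20-Λ₀, 12-Λ₀]`): there ALL cutoff weights are `1`, nothing is truncated
  (`mfFreeEnergyCT_emptyShellFrame`: `f_MF = -(βL²)⁻¹[log N^K + log|Z^K_full|]`, the Matsubara-truncated grand
  potential of the seeded torus itself, frame-independent by the Gaussian change of measure
  `dμ_{C_K} e^{-𝒩_K} ∝ dμ_{C_0}`), so the reported `m₀` IS the true finite-volume sourced anomalous density
  (`c = 1`: the BdG gap of `dWaveSourceTorus` is `h·dWaveSymbol`, tree `partitionFn_dWaveSourceTorus_zero`), the
  remainder norm is `Λ₀³‖constPart 𝒢‖ = 0` for EVERY normal form `q` (`scaledRemainderNormCT_emptyShellFrame_eq_zero`,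
  unconditional: `constPart_effAction_eq_zero`),
  and `Np = 0` is forced (`numPatches_eq_zero_of_realised_emptyShellFrame`).  On this sub-report R is the
  tautology "`fst ≤ A_L(h)` for all small `h`, large `L` ⇒ `fst/2 ≤ OP`" — and `etaStar`, `kStar` bind nothing.
* ONLY in frames with a NON-EMPTY shell at `U ≠ 0`, where the third factor `∫ dμ_{C^{K,≤}} e^{-𝒢₂}` is a genuine
  Gaussian TRUNCATION obeying no a-priori bound: its zeros (in `h'`, or approached along the frame ball) make
  `m₀ = -½∂_{h'} f_MF` arbitrarily large WITHOUT being seen by the remainder norm `η` (which reads `𝒢`, not the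
  truncated integral) — whereas zeros of `Z^{K,>}` are harmless for R (they blow up `𝒢 = -log(Z⁻¹B - 1)` and hence
  `η`).  No tree means (and no feasible computation: Grassmann algebra on `8ML²` generators, all `L ≥ L₀`) can
  evaluate that window today.  This is recorded as the standing refutation TARGET (§8, item 6) — but §8 item 7
  (one loop, on paper) indicates the window is policed: a frame dishonest by `δK` on a NON-EMPTY soft shell pays
  `η₂ ≳ min(|δK|/Λ₀, δK²/Λ₀²)`, and in an honest frame the truncated factor cannot vanish for real static normal-form
  data.  The crux resists because its two escape hatches (empty shell: unpoliced but honest; non-empty shell: policed)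
  close each other.

## Index

* §0 `RWithReport`, `crux_iff` — the crux with the model report abstracted (`Iff.rfl`).
* §1 LOAD-BEARING ANALYSIS: `junkDatum`, `junkDatum_meetsThresholds` (thresholds blind to `m₀`; 0-patch
  velocities decorative); `aposterioriOrderCriterionR_false_without_enclosure`; `rWithReport_univ_false`,
  `rWithReport_antitone`, `rWithReport_empty`; `isRealisedAtCT_noPatch_velocities`,
  `mem_reportCTAt_noPatch_velocities` (landed: `Theorems/AposterioriOrderCriterionR/Negative/LoadBearing.lean`).
* §2 `conclusion_of_fst_nonpos`, `crux_of_forall_certified_nonpos`, `conclusion_iff_stairs`,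
  `remainderNorm_snd_nonneg_of_certified`.
* §2b (cycle 2) THE HONEST CORE: `ReportHonest rep c`, **`rWithReport_of_honest`** (`c ≤ 2` ⇒ R over `rep`,
  thresholds unused), `not_rWithReport_of_dishonest_witness`.
* §3 attacks run on paper, cycle 1 (docstring of `attacksOnPaper`).
* §3b (cycle 2) CHECKED PART OF §3 ITEM 1: at `U = 0` (bare frame) `deformedEffPartitionFn = 1`, `deformedEffAction = 0`,
  **`mfFreeEnergy_free`** (`f_MF = -(βL²)⁻¹ freeLogDet`, no `Λ₀`), `scaleMeanFieldDensity_free_eq` /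
  `scaleStiffness_free_eq` / `scaleCompressibility_free_eq` (responses `Λ₀`-independent), `freeLogDet_zero_twist`
  (summand `log(ω² + ξ² + h'²φ²)`, smooth in `h'`).
* §4 Targets: none (payload `stuck_stubs = []` in both cycles).
* §5 NEAR-MISS (the only `sorry`): `nearMiss_pointwiseH_false` (the `∀ h ∃ D` variant is false at `U = 0` on
  paper); `crux_of_pointwiseH`.
* §6 (cycle 2) THE EMPTY-SHELL SUB-REPORT: `constFrame`, `emptyShellFrame μ Λ₀ = constFrame (-(μ+4+Λ₀))`,
  `isAdmissibleFrame_constFrame` (`|c| ≤ 16`), `le_nambuXiCT_emptyShellFrame` (`e_K ≥ Λ₀`),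
  `hubbardCutoffWeightCT_emptyShellFrame` (`= 1`), `deformedCovAboveCT_/deformedCovBelowCT_/hubbardCovAboveCT_emptyShellFrame`,
  `hubbardEffectiveActionCT_emptyShellFrame` (fully integrated functional), **`mfFreeEnergyCT_emptyShellFrame`**,
  `cooperKeptCT_emptyShellFrame = 0`, `scaledRemainderNormCT_emptyShellFrame` (`= Λ₀³‖constPart 𝒢‖`, every `q`),
  `constPart_effAction_eq_zero`, `scaledRemainderNormCT_emptyShellFrame_eq_zero` (unconditional),
  **`isRealisedAtCT_emptyShellFrame`** (non-vacuity of the CT predicate at EVERY coupling, every `L ≥ 1, M, β > 0`,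
  zero remainder, arbitrary velocities — the tree had `U = 0` only),
  `fermiRayCT_/nodePointCT_/fermiSpeedCT_emptyShellFrame_node` (node at `Γ`, `v_F = 0`),
  **`numPatches_eq_zero_of_realised_emptyShellFrame`**, `mem_reportCTAt_of_emptyShell_limits` (report membership
  of the fully integrated responses modulo `M → ∞` convergence only).
* §7 (cycle 2) THE FLAT-BAND FRAME: `flatFrame = ε` is ADMISSIBLE with `coeffNorm 2 = 16` exactly
  (`isAdmissibleFrame_flatFrame`); at `μ = 0`: `nambuXiCT_flatFrame = 0` on every torus, `bandGradientCT_flatFrame = 0`,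
  `fermiSpeedCT_flatFrame = 0`, `inShellCT_flatFrame` (every momentum in the shell), `hubbardCutoffWeightCT_flatFrame`
  (pure frequency cutoff), `fermiVelocity_eq_zero_of_nodal_flatFrame`.  Planner note: the admissibility bound is
  attained by the bare band; `< 16` (or a floor on `|∇e_K|` along `{e_K = 0}`) would exclude the fully degenerate frame.
* §8 (cycle 2) attack log (docstring of `attacksOnPaperCycle2`).
-/

set_option linter.dupNamespace false

namespace Summit.HubbardSuperconductivity.HubbardSuperconductivity.Cruxes.AposterioriOrderCriterionR.Disproof

open Literature.MathematicalPhysics.QuantumLattice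
open Summit.HubbardSuperconductivity.HubbardSuperconductivity.Theses.AposterioriCapRg
open Filter Set

noncomputable section

/-! ## §0 The crux with the report abstracted -/

/-- The crux `AposterioriOrderCriterionR` with the model report `hubbardScaleReportCT` replaced by an
arbitrary report family `rep U μ D h` (everything else verbatim). -/
def RWithReport (rep : ∀ (U μ : ℝ) (D : HubbardScaleData), ℝ → HubbardScaleData.Report D.numPatches) : Prop :=
  ∃ kStar etaStar : ℚ, 0 < kStar ∧ 0 < etaStar ∧ ∀ (U μ h₀ : ℝ) (D : HubbardScaleData), 0 < h₀ →
    (∀ h ∈ Set.Ioc (0:ℝ) h₀, ∃ L₀ : ℕ, D.IsCertifiedEnclosure (rep U μ D h) L₀) →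
    D.MeetsThresholds kStar etaStar → ((D.meanFieldDensity.fst : ℚ) : ℝ) / 2 ≤ dWaveOrderParameter U μ

/-- The crux IS `RWithReport hubbardScaleReportCT` (definitionally). -/
theorem crux_iff : AposterioriOrderCriterionR ↔ RWithReport hubbardScaleReportCT := Iff.rfl

/-! ## §1 Load-bearing analysis: the thresholds are blind to `m₀`; only the report binds it -/

/-- Auxiliary: `k / (k² + 1) ≤ 1` for every rational `k`. -/
theorem div_sq_add_one_le_one (k : ℚ) : k * (1 / (k ^ 2 + 1)) ≤ 1 := by
  rw [mul_one_div, div_le_one (by positivity)]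
  nlinarith [sq_nonneg (k - 1)]

/-- The **junk datum** at stiffness threshold `k` with prescribed mean-field density `m`: NO patches
(`numPatches = 0`, so no gap clause and no nodal pin), scale `Λ₀ = 1/(k²+1)`, stiffness, compressibility
and both velocities enclosed by `[1, 1]`, remainder `[0, 0]`, mean-field density `[m, m]`. -/
def junkDatum (k m : ℚ) : HubbardScaleData :=
  HubbardScaleData.mk (1 / (k ^ 2 + 1)) (by positivity) 0 ∅ Fin.elim0
    ⟨(1, 1), le_rfl⟩ ⟨(1, 1), le_rfl⟩ ⟨(1, 1), le_rfl⟩ ⟨(1, 1), le_rfl⟩ ⟨(0, 0), le_rfl⟩ ⟨(m, m), le_rfl⟩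

@[simp] theorem junkDatum_numPatches (k m : ℚ) : (junkDatum k m).numPatches = 0 := rfl
@[simp] theorem junkDatum_meanFieldDensity_fst (k m : ℚ) : (junkDatum k m).meanFieldDensity.fst = m := rfl
@[simp] theorem junkDatum_scale (k m : ℚ) : (junkDatum k m).scale = 1 / (k ^ 2 + 1) := rfl

/-- **`MeetsThresholds` never sees the mean-field density, and at `numPatches = 0` its velocity clauses
are decorative**: for every `k ≥ 0`, `e ≥ 0` and EVERY `m`, `junkDatum k m` meets `MeetsThresholds k e`. -/
theorem junkDatum_meetsThresholds {k e : ℚ} (hk : 0 ≤ k) (he : 0 ≤ e) (m : ℚ) :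
    (junkDatum k m).MeetsThresholds k e := by
  have h1 : k * (1 / (k ^ 2 + 1)) ≤ 1 := div_sq_add_one_le_one k
  have h0 : 0 ≤ k * (1 / (k ^ 2 + 1)) := mul_nonneg hk (by positivity)
  refine ⟨zero_lt_one, zero_lt_one, zero_lt_one, ?_, ?_, ?_, fun i => i.elim0, he⟩
  · show k * (1 / (k ^ 2 + 1)) * 1 ≤ 1
    simpa using h1
  · show k * (1 / (k ^ 2 + 1)) * 1 ≤ 1
    simpa using h1
  · show (k * (1 / (k ^ 2 + 1))) ^ 2 ≤ 1 * 1
    nlinarith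

/-- Packaging: thresholds are `m₀`-blind. -/
theorem meetsThresholds_blind_to_meanFieldDensity (k e : ℚ) (hk : 0 ≤ k) (he : 0 ≤ e) (m : ℚ) :
    ∃ D : HubbardScaleData, D.numPatches = 0 ∧ D.meanFieldDensity.fst = m ∧ D.MeetsThresholds k e :=
  ⟨junkDatum k m, rfl, rfl, junkDatum_meetsThresholds hk he m⟩

/-- A uniform a-priori bound on the order parameter (from the tree's `dWaveOrderParameter_le_const`,
`B_d = 2Σ_e |d(e)/√2|`, independent of `(U, μ)`). -/
theorem exists_uniform_bound_dWaveOrderParameter : ∃ B : ℝ, ∀ U μ : ℝ, dWaveOrderParameter U μ ≤ B :=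
  ⟨_, fun U μ => dWaveOrderParameter_le_const U μ⟩

/-- For every real `B` there is a rational `m` with `B < m/2`. -/
theorem exists_rat_half_gt (B : ℝ) : ∃ m : ℚ, B < ((m : ℚ) : ℝ) / 2 := by
  refine ⟨2 * (⌈B⌉₊ : ℚ) + 2, ?_⟩
  have h := Nat.le_ceil B
  push_cast
  linarith

/-- R with the ENCLOSURE HYPOTHESIS DROPPED (thresholds alone ⇒ order). -/
def AposterioriOrderCriterionRWithoutEnclosure : Prop :=
  ∃ kStar etaStar : ℚ, 0 < kStar ∧ 0 < etaStar ∧ ∀ (U μ h₀ : ℝ) (D : HubbardScaleData), 0 < h₀ →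
    D.MeetsThresholds kStar etaStar → ((D.meanFieldDensity.fst : ℚ) : ℝ) / 2 ≤ dWaveOrderParameter U μ

/-- **Any proof of R must use the enclosure hypothesis**: without it R is false — the thresholds are
met by `junkDatum kStar m` for every `m`, while `dWaveOrderParameter ≤ B_d` uniformly. -/
theorem aposterioriOrderCriterionR_false_without_enclosure : ¬ AposterioriOrderCriterionRWithoutEnclosure := by
  rintro ⟨k, e, hk, he, H⟩
  obtain ⟨B, hB⟩ := exists_uniform_bound_dWaveOrderParameter
  obtain ⟨m, hm⟩ := exists_rat_half_gt B
  have := H 0 0 1 (junkDatum k m) one_pos (junkDatum_meetsThresholds hk.le he.le m)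
  simp only [junkDatum_meanFieldDensity_fst] at this
  linarith [hB 0 0]

/-- Every datum encloses the tuple of its own left end points. -/
theorem encloses_fstTuple (D : HubbardScaleData) :
    D.Encloses ⟨fun i => (D.gap i).fst, D.stiffness.fst, D.compressibility.fst, D.fermiVelocity.fst,
      D.gapVelocity.fst, D.remainderNorm.fst, D.meanFieldDensity.fst⟩ := by
  refine ⟨fun i => ?_, ?_, ?_, ?_, ?_, ?_, ?_⟩ <;>
    exact NonemptyInterval.cast_mem_ratCast_iff.2 ⟨le_rfl, NonemptyInterval.fst_le_snd _⟩

/-- **The all-realising report makes R false** (so R's truth is the report's honesty): with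
`rep = univ` every datum is certified from `L₀ = 0`, and `junkDatum` does the rest. -/
theorem rWithReport_univ_false : ¬ RWithReport (fun _ _ _ _ => fun _ _ => Set.univ) := by
  rintro ⟨k, e, hk, he, H⟩
  obtain ⟨B, hB⟩ := exists_uniform_bound_dWaveOrderParameter
  obtain ⟨m, hm⟩ := exists_rat_half_gt B
  have hcert : ∀ h ∈ Set.Ioc (0:ℝ) 1, ∃ L₀ : ℕ,
      (junkDatum k m).IsCertifiedEnclosure (fun _ _ => Set.univ) L₀ :=
    fun h _ => ⟨0, fun L _ => ⟨0, fun β _ => ⟨_, Set.mem_univ _, encloses_fstTuple _⟩⟩⟩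
  have := H 0 0 1 (junkDatum k m) one_pos hcert (junkDatum_meetsThresholds hk.le he.le m)
  simp only [junkDatum_meanFieldDensity_fst] at this
  linarith [hB 0 0]

/-- **R is antitone in the report**: enlarging the realised sets can only falsify it. -/
theorem rWithReport_antitone
    {rep rep' : ∀ (U μ : ℝ) (D : HubbardScaleData), ℝ → HubbardScaleData.Report D.numPatches}
    (hle : ∀ U μ D h L β, rep U μ D h L β ⊆ rep' U μ D h L β) (H : RWithReport rep') : RWithReport rep := by
  obtain ⟨k, e, hk, he, H⟩ := H
  refine ⟨k, e, hk, he, fun U μ h₀ D hh₀ hcert hthr => H U μ h₀ D hh₀ (fun h hh => ?_) hthr⟩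
  obtain ⟨L₀, hL₀⟩ := hcert h hh
  exact ⟨L₀, hL₀.mono_report fun L β => hle U μ D h L β⟩

/-- **The empty report makes R vacuously true** (the other end: an over-strict report hides falsity). -/
theorem rWithReport_empty : RWithReport (fun _ _ _ _ => fun _ _ => ∅) := by
  refine ⟨1, 1, one_pos, one_pos, fun U μ h₀ D hh₀ hcert _ => ?_⟩
  obtain ⟨L₀, hL₀⟩ := hcert h₀ ⟨hh₀, le_rfl⟩
  exact absurd hL₀ (HubbardScaleData.not_isCertifiedEnclosure_empty L₀)

/-- The v1 (bare-frame) report version of R implies the crux?  No — the other way: since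
`hubbardScaleReport ⊆ hubbardScaleReportCT`, the CT crux implies its bare-frame variant (recorded so a
prover does not try to import a v1 result in the wrong direction). -/
theorem rWithReport_v1_of_crux (H : AposterioriOrderCriterionR) : RWithReport hubbardScaleReport :=
  rWithReport_antitone (fun U μ D h L β => hubbardScaleReport_subset_CT U μ D h L β) (crux_iff.1 H)

/-- **0-patch data free the velocities in the landed CT predicate**: at `Np = 0` (no nodal pin can be
stated) `IsRealisedAtCT` never reads `fermiVelocity` / `gapVelocity`. -/
theorem isRealisedAtCT_noPatch_velocities {L M : ℕ} [NeZero L] {β U μ h Λ₀ : ℝ} {K : TrigPolyC4v}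
    {nodal : Finset (Fin 0)} {p : HubbardScaleData.Parameters 0}
    (hp : IsRealisedAtCT L M β U μ h K Λ₀ 0 nodal p) (vF vΔ : ℝ) :
    IsRealisedAtCT L M β U μ h K Λ₀ 0 nodal { p with fermiVelocity := vF, gapVelocity := vΔ } := by
  obtain ⟨hβ, q, heven, hgap, hsign, hnod, hρ, hκ, hm, hη⟩ := hp
  exact ⟨hβ, q, heven, hgap, hsign, fun i _ => i.elim0, hρ, hκ, hm, hη⟩

/-- … hence the 0-patch CT REPORT is closed under arbitrary changes of the two velocities: for 0-patch
data the threshold clauses `kStar·Λ₀·v_F ≤ ρ_s`, `kStar·Λ₀·v_Δ ≤ ρ_s` are decorative (take `v = ρ_s.fst/(kStar Λ₀)`),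
leaving `(kStar Λ₀)² ≤ ρ_s κ` and `η ≤ etaStar` as the only content of `MeetsThresholds` there.  R's
hypothesis admits such data (crux [3] `SeededBrokenRegimeBoseFermiPinned` added `0 < D.numPatches` to its
own conclusion; R did not), so any proof of R must cover them. -/
theorem mem_reportCTAt_noPatch_velocities {U μ h Λ₀ : ℝ} {nodal : Finset (Fin 0)} {L : ℕ} {β : ℝ}
    {p : HubbardScaleData.Parameters 0} (hp : p ∈ hubbardScaleReportCTAt U μ h Λ₀ 0 nodal L β) (vF vΔ : ℝ) :
    { p with fermiVelocity := vF, gapVelocity := vΔ } ∈ hubbardScaleReportCTAt U μ h Λ₀ 0 nodal L β := by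
  rcases Nat.eq_zero_or_pos L with rfl | hL
  · simp at hp
  · haveI : NeZero L := NeZero.of_pos hL
    rw [mem_hubbardScaleReportCTAt_iff] at hp ⊢
    intro δ hδ
    refine (hp δ hδ).mono fun M hM => ?_
    obtain ⟨K, hK, p', hp', hclose⟩ := hM
    refine ⟨K, hK, { p' with fermiVelocity := vF, gapVelocity := vΔ },
      isRealisedAtCT_noPatch_velocities hp' vF vΔ, ?_⟩
    obtain ⟨h1, h2, h3, -, -, h6, h7⟩ := hclose
    exact ⟨h1, h2, h3, by simp [hδ], by simp [hδ], h6, h7⟩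

/-! ## §2 Why every computable regime is safe -/

/-- **A datum with `meanFieldDensity.fst ≤ 0` satisfies R's conclusion at every `(U, μ)`**
(`dWaveOrderParameter_nonneg`).  At `U = 0` — the only coupling at which the tree can exhibit reported
tuples (`isRealisedAtCT_free_noPatch`) — every CERTIFIED datum has `fst ≤ 0`, because the enclosure must
contain the free BdG anomalous density at every `h ∈ (0, h₀]` and that density is `O(h log(1/h))`
(§3); so no `U = 0` instance can refute R. -/
theorem conclusion_of_fst_nonpos (D : HubbardScaleData) (hD : D.meanFieldDensity.fst ≤ 0) (U μ : ℝ) :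
    ((D.meanFieldDensity.fst : ℚ) : ℝ) / 2 ≤ dWaveOrderParameter U μ := by
  have : ((D.meanFieldDensity.fst : ℚ) : ℝ) ≤ 0 := by exact_mod_cast hD
  linarith [dWaveOrderParameter_nonneg U μ]

/-- **Where a kill must live.**  If every datum certified against the CT report (at any `U, μ, h₀`) has
`meanFieldDensity.fst ≤ 0`, then R holds outright (with ANY thresholds).  Contrapositive: a refutation
of R needs a point `(U, μ)`, an `h₀ > 0` and a datum `D` CERTIFIED for all `h ∈ (0,h₀]` with
`0 < D.meanFieldDensity.fst` (and `2·dWaveOrderParameter U μ < fst`) — i.e. an `h`-UNIFORM positive lower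
bound on the model's scale mean-field density `scaleMeanFieldDensityCT`, which is spontaneous symmetry
breaking at mean-field-at-scale level: not available at `U = 0`, not computable at `U ≠ 0` today. -/
theorem crux_of_forall_certified_nonpos
    (H : ∀ (U μ h₀ : ℝ) (D : HubbardScaleData), 0 < h₀ →
      (∀ h ∈ Set.Ioc (0:ℝ) h₀, ∃ L₀ : ℕ, D.IsCertifiedEnclosure (hubbardScaleReportCT U μ D h) L₀) →
      D.meanFieldDensity.fst ≤ 0) :
    AposterioriOrderCriterionR :=
  ⟨1, 1, one_pos, one_pos, fun U μ h₀ D hh₀ hcert _ => conclusion_of_fst_nonpos D (H U μ h₀ D hh₀ hcert) U μ⟩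

/-- **Staircase form of the conclusion** (tree: `le_dWaveOrderParameter_iff_forall`): R's conclusion at
`(U, μ)` is the conjunction over ALL source strengths `h > 0` of `m₀.fst/2 ≤ liminf_L dWaveSourceDensity (L+1) U μ h`.
So R is equivalent to the family of single-stair statements "certified on `(0,h₀]` ⇒ floor on stair `h`"
for every `h > 0` — in particular for `h > h₀`, by monotonicity of the stairs. -/
theorem conclusion_iff_stairs (D : HubbardScaleData) (U μ : ℝ) :
    ((D.meanFieldDensity.fst : ℚ) : ℝ) / 2 ≤ dWaveOrderParameter U μ ↔
      ∀ h : ℝ, 0 < h → ((D.meanFieldDensity.fst : ℚ) : ℝ) / 2 ≤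
        liminf (fun L : ℕ => dWaveSourceDensity (L + 1) U μ h) atTop :=
  le_dWaveOrderParameter_iff_forall U μ _

/-- **A certified datum has a nonnegative remainder threshold available**: certification against the CT
report forces `0 ≤ D.remainderNorm.snd` (contrapositive of the tree's
`not_isCertifiedEnclosure_reportCT_of_remainderNorm_snd_neg`) — the report is not vacuous in `η`. -/
theorem remainderNorm_snd_nonneg_of_certified {U μ h : ℝ} {D : HubbardScaleData} {L₀ : ℕ}
    (hD : D.IsCertifiedEnclosure (hubbardScaleReportCT U μ D h) L₀) : 0 ≤ D.remainderNorm.snd := by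
  by_contra hneg
  exact not_isCertifiedEnclosure_reportCT_of_remainderNorm_snd_neg U μ h D (lt_of_not_ge hneg) L₀ hD

/-! ## §3 Attacks run on paper (no tree means to formalise; recorded for the provers) -/

/-- ATTACK LOG (cycle 1).  Notation: `φ = dWaveSymbol`, `ξ = ε - μ`, `E = √(ξ² + h²φ²)`, `ω_n` fermionic.

1. **U = 0, bare frame, any `Λ₀`, `Np = 0`** (the tree's `isRealisedAtCT_free_noPatch`).  `effAction C 0 = 0`,
   so `f_MF(a,μ',h') = -(βL²)⁻¹ Σ_{n,k} log|ω_n² + ξ₊ξ₋ + h'²φ² - iω_n(ξ₋-ξ₊)|` (Λ₀-independent), whence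
   `m₀ = (h/βL²) Σ_{n,k} φ_k²/(ω_n²+E_k²) → (h/2L²) Σ_k φ_k² tanh(βE_k/2)/E_k` (`M → ∞`), which EQUALS
   `dWaveSourceDensity L 0 μ h` at `β = ∞` (BdG: `⟨c_{k↑}c_{-k↓}⟩ = hφ_k/2E_k`; conventions match, factor ½
   of N1/rattack-13884 is harmless).  `L → ∞`: `∼ c h log(1/h) → 0`.  Since ONE `D` must enclose `m₀` for
   all `h ∈ (0,h₀]`, `L ≥ L₀(h)`: `D.meanFieldDensity.fst ≤ 0` ⇒ conclusion free (§2).  `ρ_s → ` Drude-type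
   weight `> 0`, `κ → (1/L²)Σ h²φ²/E³ > 0`: free data ARE certifiable at generic `μ` (choose `β₀(L)` past the
   near-resonance dips), thresholds met for `Λ₀ ≤ √(ρκ)/kStar` — R is TRUE-and-void there.
2. **U = 0, arbitrary admissible frames `K_M` varying with `M`**: the CT interaction at `U = 0` is the
   quadratic counterterm `𝒩_K`; Gaussian resummation is exact at finite dimension
   (`freeLogDetCT_K + log|Z^{K,>}| + log|∫dμ_{C^{K,≤}}e^{-𝒢₂}| = freeLogDet_0`, all determinants
   `ω² + (e_K + wK)² + h²φ² > 0`), so responses are frame-independent.  Even a hypothetical normalisation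
   slip in `𝒩_K` would only yield ANOTHER free A1g band: an A1g frame cannot seed an `h`-independent B1g
   anomalous density (`Σ_k φ_k · (A1g) = 0` by C4 on the C4-symmetric grid) ⇒ still `m₀ = O(h log(1/h))`.
3. **μ outside the band / frames pushing the shell off the torus**: `ρ_s = O(h²)`, so `ρ_s.fst ≤ 0 <
   kStar Λ₀ v.snd`: thresholds unmeetable (docstring claim of HubbardScaleReportCT confirmed on paper).
4. **Fermi-surface resonance `μ = 0`, `4 ∣ L`, `U = 0`**: the grid momenta `(±π/2, ±π/2)` have `ξ = φ = 0`;
   their contribution to `∂²_a freeLogDet` is `8Σ_n ω_n⁻² = 2β²` each ⇒ `ρ_s(L,β) ≈ ρ_reg - 8β/L² → -∞`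
   and `κ → +∞` as `β → ∞`: NO datum is certified at `(0, 0)` (all `L ≥ L₀` include multiples of 4) — R
   vacuous there, not refuted.  On-FS momenta with `φ ≠ 0` give `m₀ ≥ Σ_{ξ_k=0}|φ_k|/2L² = O(1/L)` only.
5. **U < 0 (s-wave), insulating μ, SDW points**: not computable in the tree; on paper `m₀ = -½∂_{h'}f_MF`
   is the B1g response, `O(h)` in an A1g condensate by C4 — the B1g-projection worry R1 of rattack-13884 is
   answered by the landed definition.
6. **Degenerate data**: `Np = 0` (§1, velocities decorative — survives because `(kStar Λ₀)² ≤ ρκ` and the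
   `m₀`-enclosure remain); `nodal = univ` with nonempty shells pins cones (genuine); empty patch-shells
   report gap `0` and free the cone velocities up to `fermiSpeedCT` at the junk node — again only with the
   shell off the grid, i.e. case 3.
7. **Natural strengthenings** — single stair (`certified at h ⇒ fst/2 ≤ F(U,μ,h)`): at `U = 0` reads
   `A(h)/2 ≤ A(h)`, true; factor `1` for `½`: at `U = 0` reads `fst ≤ 0 ≤ OP`, true.  Neither refutable here.
8. **Junk scan of the definitions read** (HubbardScaleData, HubbardScaleReport v1, HubbardScaleReportCT,
   DWaveSource, GrassmannEffectiveAction §EffectiveAction, HubbardFreeCovariance §Matsubara): `IsClose` and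
   `Encloses` cover all 7 coordinates incl. `meanFieldDensity`; `gaussExpect_one`; `matsubaraFreq ≠ 0`;
   `effAction` junk (`Ring.inverse`) only at `U ≠ 0`; `deriv`/`iteratedDeriv` junk value `0` would make
   `m₀ = 0` (helps R, not a kill).  Nothing exploitable found.
9. Literature / negatives: `ledger negatives` — only KlsOrderOpenness_refuted (needs a perturbation slot R
   lacks); barrier catalogue WeakCouplingCeiling* — about RG crossing the pairing scale, not about R. -/
theorem attacksOnPaper : True := trivial

/-! ## §3b (cycle 2) At `U = 0` in the bare frame the response functional IS the free log-determinant: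
`Λ₀` plays no role (checked part of §3 item 1) -/

section FreeCoupling

variable (L M : ℕ) [NeZero L]

omit [NeZero L] in
/-- `Z = ∫ dμ_C e^{0} = 1` for the zero interaction. -/
theorem effPartitionFn_zero_interaction {Γ : Type*} [Fintype Γ] (C : Matrix Γ Γ ℂ) :
    effPartitionFn ℂ C 0 = 1 := by
  rw [effPartitionFn, effBoltzmann, neg_zero, grassmannExp, IsNilpotent.exp_zero, gaussConv_one, map_one]

/-- At `U = 0` the deformed above-scale partition function is `1` … -/
theorem deformedEffPartitionFn_free (β μ Λ₀ μ' h' a : ℝ) : deformedEffPartitionFn L M β 0 μ Λ₀ μ' h' a = 1 := by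
  rw [deformedEffPartitionFn, hubbardInteraction_zero_coupling, effPartitionFn_zero_interaction]

/-- … and the deformed effective action is `0`. -/
theorem deformedEffAction_free (β μ Λ₀ μ' h' a : ℝ) : deformedEffAction L M β 0 μ Λ₀ μ' h' a = 0 := by
  rw [deformedEffAction, hubbardInteraction_zero_coupling, effAction_zero_interaction]

omit [NeZero L] in
/-- The quadratic part of `0` is `0`. -/
theorem quadraticPart_zero {Γ : Type*} [Fintype Γ] [DecidableEq Γ] : quadraticPart (0 : GrassmannAlgebra ℂ Γ) = 0 := by
  simp [quadraticPart]

/-- **At `U = 0` the scale-`Λ₀` mean-field free energy is the free log-determinant**, for EVERY `Λ₀` (the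
two scale-dependent factors are `log 1 = 0`): `f_MF(a, μ', h') = -(βL²)⁻¹ Σ_k log|det(-iω_k + M_{a,μ',h'}(k⃗))|`. -/
theorem mfFreeEnergy_free (β μ Λ₀ μ' h' a : ℝ) :
    mfFreeEnergy L M β 0 μ Λ₀ μ' h' a = -(1 / (β * (L : ℝ) ^ 2)) * freeLogDet L M β μ' h' a := by
  rw [mfFreeEnergy, deformedEffPartitionFn_free, norm_one, Real.log_one, add_zero, deformedEffAction_free,
    quadraticPart_zero, neg_zero, grassmannExp, IsNilpotent.exp_zero, gaussExpect_one, norm_one, Real.log_one, add_zero]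

/-- Hence at `U = 0` the three bare-frame responses do not depend on the scale `Λ₀` at all … -/
theorem scaleMeanFieldDensity_free_eq (β μ h Λ₀ Λ₀' : ℝ) :
    scaleMeanFieldDensity L M β 0 μ h Λ₀ = scaleMeanFieldDensity L M β 0 μ h Λ₀' := by
  simp only [scaleMeanFieldDensity, mfFreeEnergy_free]

/-- … nor does the free stiffness … -/
theorem scaleStiffness_free_eq (β μ h Λ₀ Λ₀' : ℝ) :
    scaleStiffness L M β 0 μ h Λ₀ = scaleStiffness L M β 0 μ h Λ₀' := by
  simp only [scaleStiffness, mfFreeEnergy_free]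

/-- … nor the free compressibility. -/
theorem scaleCompressibility_free_eq (β μ h Λ₀ Λ₀' : ℝ) :
    scaleCompressibility L M β 0 μ h Λ₀ = scaleCompressibility L M β 0 μ h Λ₀' := by
  simp only [scaleCompressibility, mfFreeEnergy_free]

/-- … explicitly, the free mean-field density is `m₀ = ½ (βL²)⁻¹ ∂_{h'} Σ_k log|den_k(h')|` at `h' = h`. -/
theorem scaleMeanFieldDensity_free (β μ h Λ₀ : ℝ) :
    scaleMeanFieldDensity L M β 0 μ h Λ₀ =
      -(1 / 2) * deriv (fun h' => -(1 / (β * (L : ℝ) ^ 2)) * freeLogDet L M β μ h' 0) h := by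
  simp only [scaleMeanFieldDensity, mfFreeEnergy_free]

/-- The same in the CT vocabulary (bare frame `K = 0`): the CT responses at `U = 0`, `K = 0` are `Λ₀`-independent. -/
theorem scaleMeanFieldDensityCT_free_zero_frame_eq (β μ h Λ₀ Λ₀' : ℝ) :
    scaleMeanFieldDensityCT L M β 0 μ h 0 Λ₀ = scaleMeanFieldDensityCT L M β 0 μ h 0 Λ₀' := by
  rw [scaleMeanFieldDensityCT_zero_frame, scaleMeanFieldDensityCT_zero_frame, scaleMeanFieldDensity_free_eq]

/-- At zero twist the free denominator is the real positive BCS denominator `ω² + ξ² + h'²φ²`: the summand of the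
free log-determinant is `log(ω² + ξ² + (h'φ)²)`, smooth in `h'` — so `deriv` above is an honest derivative and
`m₀ = (βL²)⁻¹ Σ_{n,k} h φ_k²/(ω_n² + ξ_k² + h²φ_k²)` (the Matsubara-truncated free BdG anomalous density; on paper
`→ (h/2L²)Σ_k φ_k² tanh(βE_k/2)/E_k`, then `→ dWaveSourceDensity L 0 μ h` as `β → ∞`, `= O(h log(1/h))` as `L → ∞`). -/
theorem freeLogDet_zero_twist (β μ' h' : ℝ) :
    freeLogDet L M β μ' h' 0 = ∑ k : FreqMomentum L M, Real.log (nambuDen L M β μ' h' k) := by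
  rw [freeLogDet]
  refine Finset.sum_congr rfl fun k _ => ?_
  have h0 : 0 ≤ nambuDen L M β μ' h' k := by rw [nambuDen]; positivity
  rw [deformedNambuDen_zero, Complex.norm_real, Real.norm_eq_abs, abs_of_nonneg h0]

end FreeCoupling


/-! ## §5 Near-misses (ON PAPER only — the single `sorry`s of this work file; NOT claims of the tree) -/

/-- R with the datum allowed to depend on the source strength (`∀ h ∃ D` instead of `∃ D ∀ h ∈ (0,h₀]`;
the quantifier order refuter rattack-1381 flagged as F1 and the planner repaired). -/
def AposterioriOrderCriterionRPointwiseH : Prop :=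
  ∃ kStar etaStar : ℚ, 0 < kStar ∧ 0 < etaStar ∧ ∀ (U μ h : ℝ) (D : HubbardScaleData), 0 < h →
    (∃ L₀ : ℕ, D.IsCertifiedEnclosure (hubbardScaleReportCT U μ D h) L₀) →
    D.MeetsThresholds kStar etaStar → ((D.meanFieldDensity.fst : ℚ) : ℝ) / 2 ≤ dWaveOrderParameter U μ

/-- **NEAR-MISS (on paper): the `h`-uniformity of the datum is load-bearing — `AposterioriOrderCriterionRPointwiseH`
is FALSE at `U = 0`.**  Witness: `U = 0`, `μ = -1` (no exact Fermi-surface/diagonal resonance on any torus: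
`cos(2πk/L) = 1/4` has no solution by Niven), `h = 1`, the 0-patch datum enclosing the free BdG responses at
`h = 1` — `ρ_s(L, β→∞) = (4/L²)Σ_k cos p₁ · ½(1 - ξ_k/E_k) + O(h²) > 0` (Drude-type weight; summands bounded,
no nodal spikes because the twist enters through the Doppler shift `2a sin p₁` and `∂_aξ̄|₀ = 0`),
`κ = (1/L²)Σ h²φ²/E³ > 0`, `m = (h/2L²)Σ φ²/E ≥ m₁ > 0`, `η = 0`, dips at `β ∼ 1/E_min(L)` avoided by
`β₀(L) ≫ 1/E_min(L)`; thresholds met for `Λ₀ ≤ √(ρ.fst κ.fst)/kStar`; and `dWaveOrderParameter 0 (-1) = 0`.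
FORMALISATION PLAN / COST: (a) `dWaveOrderParameter 0 μ = 0` for `μ ∈ (-4,0) ∖ {-2}` via the tree's
`dWaveOrderParameter_eq_zero_of_sublinear_gain` with `Φ(h) = C h² log(1/h)`: ground-energy gain
`Σ_k (E_k(2h) - |ξ_k|) ≤ Σ_k 4h²φ²/(|ξ_k| + h|φ_k|)` plus the torus Cooper logarithm
(`TorusFermiWeightSum.exists_sum_fermiWeight_le` at `β = 1/h`, valid for `L ≥ 1/h` = eventually in `L`) and a
ground-energy-from-partition-function lemma (`DWaveSourceFreePressure.partitionFn_dWaveSourceTorus_zero`)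
— est. 400 lines, a reusable Literature fact ("the free gas has no d-wave order"); (b) `M → ∞`, `β → ∞`,
`L`-uniform two-sided enclosures of the three derivatives of `freeLogDet` (explicit finite sums; `deriv` /
`iteratedDeriv 2` of `a ↦ Σ log‖den(a)‖`) — est. 1500+ lines.  Not attempted in cycle 1 (it would only
re-confirm the repaired quantifier order; the crux itself is untouched by it). -/
theorem nearMiss_pointwiseH_false : ¬ AposterioriOrderCriterionRPointwiseH := by
  sorry

/-- The logical relation that makes §5 a near-miss and not a kill: the crux implies NOTHING pointwise in `h`
in the falsifiable direction — it is the pointwise variant that implies the crux (a datum certified on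
`(0, h₀]` is certified at `h = h₀`). -/
theorem crux_of_pointwiseH (H : AposterioriOrderCriterionRPointwiseH) : AposterioriOrderCriterionR := by
  obtain ⟨k, e, hk, he, H⟩ := H
  exact ⟨k, e, hk, he, fun U μ h₀ D hh₀ hcert hthr => H U μ h₀ D hh₀ (hcert h₀ ⟨hh₀, le_rfl⟩) hthr⟩

/-! ## §2b The honest core of R (cycle 2) -/

/-- **Honesty of a report family in the `m₀` coordinate, with constant `c`**: at every `(U, μ)`, source
`h > 0`, volume `L + 1` and tolerance `ε > 0`, for all large `β` every reported tuple has
`m₀ ≤ c · dWaveSourceDensity (L+1) U μ h + ε` (the reported mean-field density does not exceed `c` times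
the TRUE finite-volume sourced anomalous density, asymptotically in `β`). -/
def ReportHonest (rep : ∀ (U μ : ℝ) (D : HubbardScaleData), ℝ → HubbardScaleData.Report D.numPatches)
    (c : ℝ) : Prop :=
  ∀ (U μ : ℝ) (D : HubbardScaleData) (h : ℝ), 0 < h → ∀ ε : ℝ, 0 < ε → ∀ L : ℕ, ∃ β₁ : ℝ, ∀ β : ℝ, β₁ ≤ β →
    ∀ p ∈ rep U μ D h (L + 1) β, p.meanFieldDensity ≤ c * dWaveSourceDensity (L + 1) U μ h + ε

/-- **R holds — with ANY thresholds — over every report that is honest with constant `c ≤ 2`.**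
This is the tautological core of the crux: certification at each FIXED `h ∈ (0, h₀)` gives
`fst ≤ c·A_{L+1}(h) ≤ 2·A_{L+1}(h)` for all large `L`, hence `fst/2 ≤ liminf_L A_{L+1}(h)`, hence
(`le_dWaveOrderParameter_of_forall`) `fst/2 ≤ dWaveOrderParameter U μ`.  The thresholds are not used. -/
theorem rWithReport_of_honest
    {rep : ∀ (U μ : ℝ) (D : HubbardScaleData), ℝ → HubbardScaleData.Report D.numPatches} {c : ℝ}
    (hc : c ≤ 2) (H : ReportHonest rep c) : RWithReport rep := by
  refine ⟨1, 1, one_pos, one_pos, fun U μ h₀ D hh₀ hcert _ => ?_⟩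
  refine le_dWaveOrderParameter_of_forall U μ hh₀ fun h hh => ?_
  obtain ⟨L₀, hL₀⟩ := hcert h ⟨hh.1, hh.2.le⟩
  -- eventually in `L`, `fst/2 ≤ A_{L+1}(h)`
  have hev : ∀ᶠ L : ℕ in atTop, ((D.meanFieldDensity.fst : ℚ) : ℝ) / 2 ≤ dWaveSourceDensity (L + 1) U μ h := by
    filter_upwards [eventually_ge_atTop L₀] with L hL
    obtain ⟨β₀, hβ₀⟩ := hL₀ (L + 1) (hL.trans (Nat.le_succ L))
    have hA := dWaveSourceDensity_nonneg (L := L + 1) U μ hh.1.le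
    -- `fst ≤ c A + ε` for every `ε > 0`
    have key : ∀ ε : ℝ, 0 < ε → ((D.meanFieldDensity.fst : ℚ) : ℝ) ≤ c * dWaveSourceDensity (L + 1) U μ h + ε := by
      intro ε hε
      obtain ⟨β₁, hβ₁⟩ := H U μ D h hh.1 ε hε L
      obtain ⟨p, hp, henc⟩ := hβ₀ (max β₀ β₁) (le_max_left _ _)
      exact (henc.fst_le_meanFieldDensity).trans (hβ₁ _ (le_max_right _ _) p hp)
    have hfst : ((D.meanFieldDensity.fst : ℚ) : ℝ) ≤ c * dWaveSourceDensity (L + 1) U μ h :=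
      le_of_forall_pos_lt_add fun ε hε => by linarith [key (ε / 2) (by positivity)]
    nlinarith
  refine le_liminf_of_le ?_ hev
  exact isCoboundedUnder_ge_of_eventually_le _
    (Eventually.of_forall fun L => dWaveSourceDensity_le_const (L + 1) U μ h)

/-- Conversely, the thresholds CANNOT rescue a dishonest report: if at some `(U, μ)` a report certifies —
for all `h ∈ (0, h₀]` — ONE datum meeting the thresholds whose `fst/2` exceeds the order parameter, R fails
for those thresholds (bookkeeping form of cycle 1's `exists_certified_pos_of_not_…`, report-abstract). -/
theorem not_rWithReport_of_dishonest_witness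
    {rep : ∀ (U μ : ℝ) (D : HubbardScaleData), ℝ → HubbardScaleData.Report D.numPatches}
    (W : ∀ kStar etaStar : ℚ, 0 < kStar → 0 < etaStar → ∃ (U μ h₀ : ℝ) (D : HubbardScaleData), 0 < h₀ ∧
      (∀ h ∈ Set.Ioc (0:ℝ) h₀, ∃ L₀ : ℕ, D.IsCertifiedEnclosure (rep U μ D h) L₀) ∧
      D.MeetsThresholds kStar etaStar ∧ dWaveOrderParameter U μ < ((D.meanFieldDensity.fst : ℚ) : ℝ) / 2) :
    ¬ RWithReport rep := by
  rintro ⟨k, e, hk, he, HR⟩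
  obtain ⟨U, μ, h₀, D, hh₀, hcert, hthr, hlt⟩ := W k e hk he
  exact absurd (HR U μ h₀ D hh₀ hcert hthr) (not_le.2 hlt)

/-! ## §6 The empty-shell sub-report (cycle 2)

Constant frames `K ≡ c` are admissible for `|c| ≤ 16`.  With `c = -(μ + 4 + Λ₀)` the renormalised band is
`e_K = ε_L + 4 + Λ₀ ≥ Λ₀` on EVERY torus: the spatial shell is empty, every cutoff weight is `1`, every field is
integrated, nothing is truncated, no Cooper term is kept, every leg weight vanishes.  ON PAPER the consequence is
that `f^K_MF(a, μ', h') = -(βL²)⁻¹ log|det C_0^{-1}(a,μ',h') · ∫dμ_{C_0} e^{-UV}|` + const is the Matsubara-truncated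
grand potential of the deformed seeded torus (Gaussian change of measure `C_K^{-1} + N_K = C_0^{-1}`, exact at finite
`M`), so `(ρ_s, κ, m₀) → ` the TRUE finite-volume responses as `M → ∞`, then `β → ∞` (tracial ground state), and in
particular `m₀ → dWaveSourceDensity L U μ h` (Hellmann–Feynman, same source normalisation).  IN LEAN we prove the
structural half: the frame, the weights, the collapse of `f_MF` to two factors, the vanishing remainder norm, the
realised tuple, the forcing of `Np = 0`, and report membership modulo the two analytic limits. -/

section EmptyShell

open Literature.Probability.LatticeModels GrassmannAlgebra

def constFrame (c : ℝ) : TrigPolyC4v := ⟨0, fun m n => if m = 0 ∧ n = 0 then c else 0⟩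
@[simp] theorem constFrame_degree (c : ℝ) : (constFrame c).degree = 0 := rfl
@[simp] theorem constFrame_coeff (c : ℝ) (m n : ℕ) :
    (constFrame c).coeff m n = if m = 0 ∧ n = 0 then c else 0 := rfl
@[simp] theorem harmonic_zero_zero (p : Fin 2 → ℝ) : TrigPolyC4v.harmonic 0 0 p = 1 := by
  simp [TrigPolyC4v.harmonic]
@[simp] theorem eval_constFrame (c : ℝ) (p : Fin 2 → ℝ) : (constFrame c).eval p = c := by
  simp [TrigPolyC4v.eval]
@[simp] theorem harmonicGrad_zero_zero (p : Fin 2 → ℝ) : TrigPolyC4v.harmonicGrad 0 0 p = 0 := by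
  funext i; fin_cases i <;> simp [TrigPolyC4v.harmonicGrad]
@[simp] theorem evalGrad_constFrame (c : ℝ) (p : Fin 2 → ℝ) : (constFrame c).evalGrad p = 0 := by
  funext i; simp [TrigPolyC4v.evalGrad]
@[simp] theorem nambuXiCT_constFrame (L : ℕ) (μ c : ℝ) (k : TorusSite 2 L) :
    nambuXiCT L μ (constFrame c) k = nambuXi L μ k - c := by
  simp [nambuXiCT, nambuXi]
def emptyShellConst (μ Λ₀ : ℝ) : ℝ := -(μ + 4 + Λ₀)
abbrev emptyShellFrame (μ Λ₀ : ℝ) : TrigPolyC4v := constFrame (emptyShellConst μ Λ₀)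
theorem le_nambuXiCT_emptyShellFrame (L : ℕ) (μ Λ₀ : ℝ) (k : TorusSite 2 L) :
    Λ₀ ≤ nambuXiCT L μ (emptyShellFrame μ Λ₀) k := by
  rw [nambuXiCT_constFrame, nambuXi, emptyShellConst]
  linarith [neg_four_le_torusBand L k]
theorem not_inFreqShellCT_emptyShellFrame (L M : ℕ) [NeZero L] (β μ : ℝ) {Λ₀ : ℝ} (hΛ : 0 ≤ Λ₀)
    (k : FreqMomentum L M) : ¬ InFreqShellCT L M β μ (emptyShellFrame μ Λ₀) Λ₀ k := by
  rw [InFreqShellCT, not_lt]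
  have h1 := le_nambuXiCT_emptyShellFrame L μ Λ₀ k.2
  nlinarith [sq_nonneg (matsubaraFreq β M k.1)]
theorem hubbardCutoffWeightCT_emptyShellFrame (L M : ℕ) (β μ : ℝ) {Λ₀ : ℝ} (hΛ : 0 < Λ₀)
    (k : FreqMomentum L M) : hubbardCutoffWeightCT L M β μ (emptyShellFrame μ Λ₀) Λ₀ k = 1 := by
  rw [hubbardCutoffWeightCT]
  apply salmhoferCutoff_of_ge
  rw [le_div_iff₀ (by positivity), one_mul]
  have h1 := le_nambuXiCT_emptyShellFrame L μ Λ₀ k.2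
  nlinarith [sq_nonneg (matsubaraFreq β M k.1)]

theorem isAdmissibleFrame_constFrame {c : ℝ} (hc : |c| ≤ 16) : IsAdmissibleFrame (constFrame c) := by
  rw [isAdmissibleFrame_iff]; simpa [TrigPolyC4v.coeffNorm] using hc
theorem patchShellCT_emptyShellFrame' (L : ℕ) [NeZero L] (μ : ℝ) (Λ₀ : ℚ) (Np : ℕ) (i : Fin Np) :
    patchShellCT L μ (emptyShellFrame μ (Λ₀ : ℝ)) (Λ₀ : ℝ) Np i = ∅ := by
  ext k
  simp only [Finset.notMem_empty, iff_false]
  rw [mem_patchShellCT_iff, not_and, not_lt]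
  intro _
  exact (le_nambuXiCT_emptyShellFrame L μ Λ₀ k).trans (le_abs_self _)

/-! ### Everything above scale, nothing truncated -/

variable (L M : ℕ)

/-- **Everything is above scale**: in the empty-shell frame the deformed covariance above scale IS the
deformed covariance (for every deformation `(μ', h', a)`). -/
theorem deformedCovAboveCT_emptyShellFrame (β μ : ℝ) {Λ₀ : ℝ} (hΛ : 0 < Λ₀) (μ' h' a : ℝ) :
    deformedCovAboveCT L M β μ (emptyShellFrame μ Λ₀) Λ₀ μ' h' a =
      deformedCovarianceCT L M β μ' h' (emptyShellFrame μ Λ₀) a := by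
  ext X Y
  simp only [deformedCovAboveCT, Matrix.of_apply, hubbardCutoffWeightCT_emptyShellFrame L M β μ hΛ]
  norm_num

/-- … and nothing is below scale. -/
theorem deformedCovBelowCT_emptyShellFrame (β μ : ℝ) {Λ₀ : ℝ} (hΛ : 0 < Λ₀) (μ' h' a : ℝ) :
    deformedCovBelowCT L M β μ (emptyShellFrame μ Λ₀) Λ₀ μ' h' a = 0 := by
  rw [deformedCovBelowCT, deformedCovAboveCT_emptyShellFrame L M β μ hΛ, sub_self]

/-- Undeformed version: `C^{K,>}_{Λ₀} = C^K`. -/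
theorem hubbardCovAboveCT_emptyShellFrame (β μ h : ℝ) {Λ₀ : ℝ} (hΛ : 0 < Λ₀) :
    hubbardCovAboveCT L M β μ h (emptyShellFrame μ Λ₀) Λ₀ = hubbardCovarianceCT L M β μ h (emptyShellFrame μ Λ₀) := by
  ext X Y
  simp only [hubbardCovAboveCT, Matrix.of_apply, hubbardCutoffWeightCT_emptyShellFrame L M β μ hΛ]
  norm_num

variable [NeZero L]

/-- **The CT effective action in the empty-shell frame is the FULLY INTEGRATED functional**
`effAction C^K (V + 𝒩_K)` (no field is kept). -/
theorem hubbardEffectiveActionCT_emptyShellFrame (β U μ h : ℝ) {Λ₀ : ℝ} (hΛ : 0 < Λ₀) :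
    hubbardEffectiveActionCT L M β U μ h (emptyShellFrame μ Λ₀) Λ₀ =
      effAction ℂ (hubbardCovarianceCT L M β μ h (emptyShellFrame μ Λ₀))
        (hubbardInteractionCT L M β U (emptyShellFrame μ Λ₀)) := by
  rw [hubbardEffectiveActionCT, hubbardCovAboveCT_emptyShellFrame L M β μ h hΛ]

omit [NeZero L] in
/-- The quadratic part of any Grassmann polynomial has no constant part. -/
theorem constPart_quadraticPart {Γ : Type*} [Fintype Γ] [DecidableEq Γ] (F : GrassmannAlgebra ℂ Γ) :
    constPart ℂ (quadraticPart F) = 0 := by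
  simp [quadraticPart, map_sum]

omit [NeZero L] in
/-- `∫ dμ_0 e^{-F₂} = 1`: with zero covariance the Gaussian expectation is the constant part, and the
exponential of a quadratic form has constant part `1`. -/
theorem gaussExpect_zero_grassmannExp_neg_quadraticPart {Γ : Type*} [Fintype Γ] [DecidableEq Γ]
    (F : GrassmannAlgebra ℂ Γ) :
    gaussExpect ℂ (0 : Matrix Γ Γ ℂ) (grassmannExp (-quadraticPart F)) = 1 := by
  have h0 : constPart ℂ (-quadraticPart F) = 0 := by rw [map_neg, constPart_quadraticPart, neg_zero]
  have hn : IsNilpotent (-quadraticPart F) := isNilpotent_of_constPart_eq_zero ℂ h0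
  rw [gaussExpect_apply, gaussConv_zero, Module.End.one_apply, grassmannExp, IsNilpotent.map_exp hn, h0,
    IsNilpotent.exp_zero]

/-- **The scale-`Λ₀` mean-field free energy in the empty-shell frame has NO truncated factor**:
`f^K_MF(a, μ', h') = -(βL²)⁻¹ [log N^K + log |Z^K_full|]`, `Z^K_full = ∫ dμ_{C^K_{a,μ',h'}} e^{-V-𝒩_K}` —
the (Matsubara-truncated) grand potential of the deformed seeded torus itself, re-bracketed. -/
theorem mfFreeEnergyCT_emptyShellFrame (β U μ : ℝ) {Λ₀ : ℝ} (hΛ : 0 < Λ₀) (μ' h' a : ℝ) :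
    mfFreeEnergyCT L M β U μ (emptyShellFrame μ Λ₀) Λ₀ μ' h' a =
      -(1 / (β * (L : ℝ) ^ 2)) *
        (freeLogDetCT L M β μ' h' (emptyShellFrame μ Λ₀) a +
          Real.log ‖effPartitionFn ℂ (deformedCovarianceCT L M β μ' h' (emptyShellFrame μ Λ₀) a)
            (hubbardInteractionCT L M β U (emptyShellFrame μ Λ₀))‖) := by
  rw [mfFreeEnergyCT, deformedCovBelowCT_emptyShellFrame L M β μ hΛ, gaussExpect_zero_grassmannExp_neg_quadraticPart,
    norm_one, Real.log_one, add_zero, deformedEffPartitionFnCT, deformedCovAboveCT_emptyShellFrame L M β μ hΛ]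

/-- **No Cooper term is kept in the empty-shell frame** (no leg is below scale). -/
theorem cooperKeptCT_emptyShellFrame (β μ : ℝ) {Λ₀ : ℝ} (hΛ : 0 ≤ Λ₀) (F : HubbardGrassmann L M) :
    cooperKeptCT L M β μ (emptyShellFrame μ Λ₀) Λ₀ F = 0 := by
  classical
  simp [cooperKeptCT, not_inFreqShellCT_emptyShellFrame L M β μ hΛ]

/-- Hence the CT remainder in the empty-shell frame is `𝒢^K - 𝒬(q)`. -/
theorem remainderOfCT_emptyShellFrame (β U μ h : ℝ) {Λ₀ : ℝ} (hΛ : 0 ≤ Λ₀) {Np : ℕ} (q : HubbardNormalForm L Np) :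
    remainderOfCT L M β U μ h (emptyShellFrame μ Λ₀) Λ₀ q =
      hubbardEffectiveActionCT L M β U μ h (emptyShellFrame μ Λ₀) Λ₀ - normalFormQuadratic L M β q := by
  rw [remainderOfCT, cooperKeptCT_emptyShellFrame L M β μ hΛ, sub_zero]

omit [NeZero L] in
/-- Both leg weights vanish identically in the empty-shell frame. -/
theorem shellLegWeightCT_emptyShellFrame (β μ : ℝ) {Λ₀ : ℝ} (hΛ : 0 < Λ₀) :
    shellLegWeightCT L M β μ (emptyShellFrame μ Λ₀) Λ₀ = fun _ => 0 := by
  funext X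
  rw [shellLegWeightCT, hubbardCutoffWeightCT_emptyShellFrame L M β μ hΛ, sub_self, Real.sqrt_zero]

omit [NeZero L] in
theorem energyLegWeightCT_emptyShellFrame (β μ h : ℝ) {Λ₀ : ℝ} (hΛ : 0 < Λ₀) {Np : ℕ} (q : HubbardNormalForm L Np) :
    energyLegWeightCT L M β μ h (emptyShellFrame μ Λ₀) Λ₀ q = fun _ => 0 := by
  funext X
  rw [energyLegWeightCT, hubbardCutoffWeightCT_emptyShellFrame L M β μ hΛ, sub_self, zero_mul, Real.sqrt_zero]

omit [NeZero L] in
/-- A leg-weighted norm with the ZERO weight vanishes in every positive degree. -/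
theorem legKernelNorm_zero_weight {𝕜 : Type*} [RCLike 𝕜] {Γ : Type*} [Fintype Γ] [DecidableEq Γ]
    (ε : ℝ) (m : ℕ) (K : (Fin (m + 1) → Γ) → 𝕜) : legKernelNorm (fun _ : Γ => (0 : ℝ)) ε (m + 1) K = 0 := by
  rw [legKernelNorm_succ]
  simp

/-- The quadratic quasiparticle form has no constant part. -/
theorem constPart_normalFormQuadratic (β : ℝ) {Np : ℕ} (q : HubbardNormalForm L Np) :
    constPart ℂ (normalFormQuadratic L M β q) = 0 := by
  simp [normalFormQuadratic, map_sum, psiPlus, psiMinus, -Complex.coe_smul]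

/-- **The CT scaled remainder norm in the empty-shell frame** is `Λ₀³ · |const part of 𝒢^K|`, for
EVERY normal-form datum `q` (all leg weights vanish; only the degree-`0` kernel survives). -/
theorem scaledRemainderNormCT_emptyShellFrame (β U μ h : ℝ) {Λ₀ : ℝ} (hΛ : 0 < Λ₀) {Np : ℕ}
    (q : HubbardNormalForm L Np) :
    scaledRemainderNormCT L M β U μ h (emptyShellFrame μ Λ₀) Λ₀ q =
      Λ₀ ^ (3 : ℤ) * ‖constPart ℂ (hubbardEffectiveActionCT L M β U μ h (emptyShellFrame μ Λ₀) Λ₀)‖ := by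
  rw [scaledRemainderNormCT, Finset.sum_eq_single_of_mem 0 (by simp)]
  · simp only [CharP.cast_eq_zero, mul_zero, zero_sub, neg_neg, if_neg (show (0:ℕ) ≠ 2 by decide),
      legKernelNorm_zero_left, weightedKernel_def, pow_zero, kernel_zero,
      remainderOfCT_emptyShellFrame L M β U μ h hΛ.le, map_sub, constPart_normalFormQuadratic, sub_zero]
    simp
  · intro m _ hm
    obtain ⟨m, rfl⟩ := Nat.exists_eq_succ_of_ne_zero hm
    have hw : (if m + 1 = 2 then shellLegWeightCT L M β μ (emptyShellFrame μ Λ₀) Λ₀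
        else energyLegWeightCT L M β μ h (emptyShellFrame μ Λ₀) Λ₀ q) = fun _ => 0 := by
      split_ifs
      · exact shellLegWeightCT_emptyShellFrame L M β μ hΛ
      · exact energyLegWeightCT_emptyShellFrame L M β μ h hΛ q
    rw [hw, legKernelNorm_zero_weight, mul_zero]

omit [NeZero L] in
/-- **The Wilsonian effective action never has a constant part** — also in the junk case `Z` not a unit, where
`effAction = -log1p(0 • B - 1) = -log1p(-1) = 0` (truncated log of a non-nilpotent element = empty sum):
`constPart` of the always-nilpotent `grassmannLog1p` is a nilpotent complex number. -/
theorem constPart_effAction_eq_zero {Γ : Type*} [Fintype Γ] (C : Matrix Γ Γ ℂ) (V : GrassmannAlgebra ℂ Γ) :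
    constPart ℂ (effAction ℂ C V) = 0 := by
  rw [effAction_def, map_neg, neg_eq_zero]
  exact ((isNilpotent_grassmannLog1p ℂ _).map (constPart ℂ)).eq_zero

/-- … hence the CT scaled remainder norm of the empty-shell frame VANISHES for every `q`, UNCONDITIONALLY. -/
theorem scaledRemainderNormCT_emptyShellFrame_eq_zero (β U μ h : ℝ) {Λ₀ : ℝ} (hΛ : 0 < Λ₀) {Np : ℕ}
    (q : HubbardNormalForm L Np) :
    scaledRemainderNormCT L M β U μ h (emptyShellFrame μ Λ₀) Λ₀ q = 0 := by
  rw [scaledRemainderNormCT_emptyShellFrame L M β U μ h hΛ, hubbardEffectiveActionCT, constPart_effAction_eq_zero,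
    norm_zero, mul_zero]

/-- The tuple realised in the empty-shell frame on NO patches: the responses of the fully integrated
functional, ARBITRARY velocities, zero remainder. -/
def emptyShellTuple (β U μ h Λ₀ vF vΔ : ℝ) : HubbardScaleData.Parameters 0 :=
  ⟨Fin.elim0, scaleStiffnessCT L M β U μ h (emptyShellFrame μ Λ₀) Λ₀,
    scaleCompressibilityCT L M β U μ h (emptyShellFrame μ Λ₀) Λ₀, vF, vΔ, 0,
    scaleMeanFieldDensityCT L M β U μ h (emptyShellFrame μ Λ₀) Λ₀⟩

/-- **Non-vacuity of the CT predicate AT EVERY COUPLING, unconditionally** (new; the tree had it at `U = 0`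
only): the empty-shell frame realises, on no patches, the responses of the fully integrated functional with
ZERO remainder and arbitrary velocities, for every `L ≥ 1`, `M`, `β > 0`, `U`, `μ`, `h`, `Λ₀ > 0`. -/
theorem isRealisedAtCT_emptyShellFrame {β : ℝ} (hβ : 0 < β) (U μ h : ℝ) {Λ₀ : ℝ} (hΛ : 0 < Λ₀) (vF vΔ : ℝ) :
    IsRealisedAtCT L M β U μ h (emptyShellFrame μ Λ₀) Λ₀ 0 ∅ (emptyShellTuple L M β U μ h Λ₀ vF vΔ) :=
  ⟨hβ, HubbardNormalForm.trivial L 0, HubbardNormalForm.trivial_isEven L, fun i => i.elim0,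
    fun i _ => i.elim0, fun i _ => i.elim0, rfl, rfl, rfl,
    (scaledRemainderNormCT_emptyShellFrame_eq_zero L M β U μ h hΛ _).le⟩


/-! ### Geometry of the empty-shell frame: node at `Γ`, zero Fermi speed; `Np = 0` is forced -/

omit [NeZero L] in
/-- In the empty-shell frame the "renormalised Fermi radius" is the junk value `0` in every direction
(`μ + c = -4 - Λ₀ ≤ ε` everywhere, so the defining set is `[0, ∞)`). -/
theorem fermiRayCT_emptyShellFrame (μ : ℝ) {Λ₀ : ℝ} (hΛ : 0 ≤ Λ₀) (θ : ℝ) :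
    fermiRayCT μ (emptyShellFrame μ Λ₀) θ = 0 := by
  rw [fermiRayCT]
  have hset : {t : ℝ | 0 ≤ t ∧ μ + (emptyShellFrame μ Λ₀).eval (t • dir θ) ≤ sqDispersion (t • dir θ)} = Set.Ici 0 := by
    ext t
    simp only [Set.mem_setOf_eq, Set.mem_Ici, eval_constFrame, emptyShellConst, and_iff_left_iff_imp]
    intro _
    linarith [neg_four_le_sqDispersion (t • dir θ)]
  rw [hset, csInf_Ici]

omit [NeZero L] in
/-- … so every CT reference node sits at `Γ = 0`. -/
theorem nodePointCT_emptyShellFrame (μ : ℝ) {Λ₀ : ℝ} (hΛ : 0 ≤ Λ₀) (Np : ℕ) (i : Fin Np) :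
    nodePointCT μ (emptyShellFrame μ Λ₀) Np i = 0 := by
  rw [nodePointCT, fermiRayCT_emptyShellFrame μ hΛ, zero_smul]

omit [NeZero L] in
/-- A constant frame does not change the band gradient. -/
@[simp] theorem bandGradientCT_constFrame (c : ℝ) (k : Fin 2 → ℝ) : bandGradientCT (constFrame c) k = bandGradient k := by
  rw [bandGradientCT, evalGrad_constFrame, sub_zero]

omit [NeZero L] in
@[simp] theorem bandGradient_zero : bandGradient 0 = 0 := by
  funext i; fin_cases i <;> simp [bandGradient]

omit [NeZero L] in
/-- … where the Fermi speed VANISHES: a patch declared nodal reports `v_F = 0` in the empty-shell frame. -/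
theorem fermiSpeedCT_emptyShellFrame_node (μ : ℝ) {Λ₀ : ℝ} (hΛ : 0 ≤ Λ₀) (Np : ℕ) (i : Fin Np) :
    fermiSpeedCT (emptyShellFrame μ Λ₀) (nodePointCT μ (emptyShellFrame μ Λ₀) Np i) = 0 := by
  rw [nodePointCT_emptyShellFrame μ hΛ, fermiSpeedCT, bandGradientCT_constFrame, bandGradient_zero]
  simp

/-- **`Np = 0` is forced.**  A tuple realised in the empty-shell frame at the datum's own scale on
`Np ≥ 1` patches is NEVER enclosed by a datum meeting the thresholds (any positive gap ratio `c`, any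
`kStar`, `etaStar`): a non-nodal patch reports the gap `0` (empty patch-shell), a nodal one reports
`v_F = 0` (node at `Γ`).  So through this frame only 0-patch data are certifiable-and-thresholded. -/
theorem numPatches_eq_zero_of_realised_emptyShellFrame (D : HubbardScaleData) {β U μ h : ℝ}
    {p : HubbardScaleData.Parameters D.numPatches}
    (hp : IsRealisedAtCT L M β U μ h (emptyShellFrame μ (D.scale : ℝ)) (D.scale : ℝ) D.numPatches D.nodal p)
    (henc : D.Encloses p) {c kStar etaStar : ℚ} (hc : 0 < c) (hthr : D.MeetsThresholdsWith c kStar etaStar) :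
    D.numPatches = 0 := by
  by_contra hN
  set i : Fin D.numPatches := ⟨0, Nat.pos_of_ne_zero hN⟩
  obtain ⟨-, q, -, hgap, -, hnod, -, -, -, -⟩ := hp
  obtain ⟨-, hvF, -, -, -, -, hg, -⟩ := hthr
  obtain ⟨hgenc, -, -, hvFenc, -, -, -⟩ := henc
  have hΛ : (0 : ℝ) ≤ (D.scale : ℝ) := by exact_mod_cast D.scale_pos.le
  by_cases hi : i ∈ D.nodal
  · obtain ⟨-, -, -, hv, -⟩ := hnod i hi
    rw [fermiSpeedCT_emptyShellFrame_node μ hΛ, mul_zero, zero_div] at hv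
    rw [hv, NonemptyInterval.mem_ratCast_iff] at hvFenc
    have : (0 : ℝ) < D.fermiVelocity.fst := by exact_mod_cast hvF
    linarith [hvFenc.1]
  · have h0 : p.gap i = 0 := (hgap i).eq_zero (patchShellCT_emptyShellFrame' L μ D.scale D.numPatches i)
    have hgi := hgenc i
    rw [h0, NonemptyInterval.mem_ratCast_iff] at hgi
    have hcΛ : (0 : ℝ) < c * D.scale := by
      have : (0 : ℚ) < c * D.scale := mul_pos hc D.scale_pos
      exact_mod_cast this
    rcases hg i hi with h | h
    · have h' : ((c * D.scale : ℚ) : ℝ) ≤ (D.gap i).fst := Rat.cast_le.2 h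
      push_cast at h'
      linarith [hgi.1]
    · have h' : ((D.gap i).snd : ℝ) ≤ ((-(c * D.scale) : ℚ) : ℝ) := Rat.cast_le.2 h
      push_cast at h'
      linarith [hgi.2]

/-! ### Report membership of the fully integrated responses, modulo convergence in `M` -/

/-- **The CT report contains the fully integrated responses** (modulo ONE analytic fact left as
hypothesis: convergence of the three Matsubara-truncated responses as `M → ∞`): for `|μ + 4 + Λ₀| ≤ 16` the
limit tuple `(ρ, κ, vF, vΔ, 0, m)` — ANY velocities, ZERO remainder — is reported on no patches at every
`(L, β)`, `L ≥ 1`, `β > 0`. -/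
theorem mem_reportCTAt_of_emptyShell_limits {β : ℝ} (hβ : 0 < β) (U μ h : ℝ) {Λ₀ : ℝ} (hΛ : 0 < Λ₀)
    (hadm : |μ + 4 + Λ₀| ≤ 16) (vF vΔ ρ κ m : ℝ)
    (hρ : Tendsto (fun M => scaleStiffnessCT L M β U μ h (emptyShellFrame μ Λ₀) Λ₀) atTop (nhds ρ))
    (hκ : Tendsto (fun M => scaleCompressibilityCT L M β U μ h (emptyShellFrame μ Λ₀) Λ₀) atTop (nhds κ))
    (hm : Tendsto (fun M => scaleMeanFieldDensityCT L M β U μ h (emptyShellFrame μ Λ₀) Λ₀) atTop (nhds m)) :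
    (⟨Fin.elim0, ρ, κ, vF, vΔ, 0, m⟩ : HubbardScaleData.Parameters 0) ∈ hubbardScaleReportCTAt U μ h Λ₀ 0 ∅ L β := by
  rw [mem_hubbardScaleReportCTAt_iff]
  intro δ hδ
  have hρ' := (Metric.tendsto_nhds.1 hρ) δ hδ
  have hκ' := (Metric.tendsto_nhds.1 hκ) δ hδ
  have hm' := (Metric.tendsto_nhds.1 hm) δ hδ
  refine ((hρ'.and (hκ'.and hm')).mono fun M ⟨hρM, hκM, hmM⟩ => ?_).frequently
  refine ⟨emptyShellFrame μ Λ₀, isAdmissibleFrame_constFrame (by rwa [emptyShellConst, abs_neg]),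
    emptyShellTuple L M β U μ h Λ₀ vF vΔ, isRealisedAtCT_emptyShellFrame L M hβ U μ h hΛ vF vΔ, ?_⟩
  refine ⟨fun i => i.elim0, ?_, ?_, by simp [emptyShellTuple, hδ], by simp [emptyShellTuple, hδ],
    by simp [emptyShellTuple, hδ], ?_⟩
  · simpa [emptyShellTuple, Real.dist_eq, abs_sub_comm] using hρM
  · simpa [emptyShellTuple, Real.dist_eq, abs_sub_comm] using hκM
  · simpa [emptyShellTuple, Real.dist_eq, abs_sub_comm] using hmM


end EmptyShell

section FlatFrame

open Literature.Probability.LatticeModels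

/-! ## §7 The flat-band frame `K = ε` at `μ = 0`: the admissibility bound is ATTAINED by the bare band (cycle 2) -/

/-- The **flat-band frame** `K = ε = -4 h_{1,0}` (the bare band itself as a counterterm). -/
def flatFrame : TrigPolyC4v := ⟨1, fun m n => if m = 1 ∧ n = 0 then -4 else 0⟩

@[simp] theorem flatFrame_degree : flatFrame.degree = 1 := rfl
@[simp] theorem flatFrame_coeff (m n : ℕ) : flatFrame.coeff m n = if m = 1 ∧ n = 0 then -4 else 0 := rfl

/-- `K(p) = ε(p) = -2(cos p₁ + cos p₂)`. -/
theorem eval_flatFrame (p : Fin 2 → ℝ) : flatFrame.eval p = sqDispersion p := by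
  simp [TrigPolyC4v.eval, Finset.sum_range_succ, TrigPolyC4v.harmonic, sqDispersion]
  ring

/-- Its order-`2` coefficient weight is EXACTLY the admissibility bound `16`. -/
theorem coeffNorm_two_flatFrame : flatFrame.coeffNorm 2 = 16 := by
  simp [TrigPolyC4v.coeffNorm, Finset.sum_range_succ]
  norm_num

/-- **The flat-band frame is admissible** (`coeffNorm 2 = 16 ≤ 16`: the designer's bound is attained). -/
theorem isAdmissibleFrame_flatFrame : IsAdmissibleFrame flatFrame := by
  rw [isAdmissibleFrame_iff, coeffNorm_two_flatFrame]

/-- **At `μ = 0` the renormalised band of the flat-band frame vanishes IDENTICALLY on every torus**: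
`e_K(k) = ε_L(k) - 0 - ε(p_k) = 0`. -/
theorem nambuXiCT_flatFrame (L : ℕ) (k : TorusSite 2 L) : nambuXiCT L 0 flatFrame k = 0 := by
  rw [nambuXiCT, eval_flatFrame, torusBand, sqDispersion, Fin.sum_univ_two]
  ring

/-- The gradient of the flat-band frame is the band gradient … -/
theorem evalGrad_flatFrame (p : Fin 2 → ℝ) : flatFrame.evalGrad p = bandGradient p := by
  funext i
  fin_cases i <;>
    simp [TrigPolyC4v.evalGrad, Finset.sum_range_succ, TrigPolyC4v.harmonicGrad, bandGradient] <;> ring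

/-- … so the renormalised band gradient vanishes everywhere … -/
theorem bandGradientCT_flatFrame (p : Fin 2 → ℝ) : bandGradientCT flatFrame p = 0 := by
  rw [bandGradientCT, evalGrad_flatFrame, sub_self]

/-- … and so does the renormalised Fermi speed: every patch declared nodal reports `v_F = 0` in this
frame (thresholds unmeetable), while EVERY momentum is in the spatial shell. -/
theorem fermiSpeedCT_flatFrame (p : Fin 2 → ℝ) : fermiSpeedCT flatFrame p = 0 := by
  simp [fermiSpeedCT, bandGradientCT_flatFrame]

/-- At `μ = 0` every torus momentum lies in the spatial shell of the flat-band frame (`Λ₀ > 0`). -/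
theorem inShellCT_flatFrame (L : ℕ) {Λ₀ : ℝ} (hΛ : 0 < Λ₀) (k : TorusSite 2 L) : InShellCT L 0 flatFrame Λ₀ k := by
  rw [InShellCT, nambuXiCT_flatFrame, abs_zero]; exact hΛ

/-- The CT cutoff of the flat-band frame at `μ = 0` is a PURE FREQUENCY cutoff `χ₂(ω²/Λ₀²)`: all spatial
momenta with `|ω| < Λ₀/2` are kept, the quadratic truncation `𝒢 ↦ 𝒢₂` then runs over the whole zone. -/
theorem hubbardCutoffWeightCT_flatFrame (L M : ℕ) (β Λ₀ : ℝ) (k : FreqMomentum L M) :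
    hubbardCutoffWeightCT L M β 0 flatFrame Λ₀ k = salmhoferCutoff (matsubaraFreq β M k.1 ^ 2 / Λ₀ ^ 2) := by
  rw [hubbardCutoffWeightCT, nambuXiCT_flatFrame]
  ring_nf

/-- In the flat-band frame a nodal pin forces the reported Fermi velocity to vanish. -/
theorem fermiVelocity_eq_zero_of_nodal_flatFrame {L M : ℕ} [NeZero L] {Np : ℕ} {β U h Λ₀ : ℝ}
    {nodal : Finset (Fin Np)} {p : HubbardScaleData.Parameters Np}
    (hp : IsRealisedAtCT L M β U 0 h flatFrame Λ₀ Np nodal p) {i : Fin Np} (hi : i ∈ nodal) :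
    p.fermiVelocity = 0 := by
  obtain ⟨-, q, -, -, -, hnod, -⟩ := hp
  obtain ⟨-, -, -, hv, -⟩ := hnod i hi
  rw [hv, fermiSpeedCT_flatFrame, mul_zero, zero_div]


end FlatFrame

/-! ## §8 Attack log, cycle 2 (on paper where not in §2b/§6/§7) -/

/-- ATTACK LOG (cycle 2).

1. **Definition audit of the response functional** `mfFreeEnergyCT = -(βL²)⁻¹[F_K + log‖Z^{K,>}‖ + log‖Z₂‖]`,
   `Z₂ = ∫dμ_{C^{K,≤}} e^{-𝒢₂}`, `𝒢 = -log1p(Z⁻¹·B - 1)` with `Z⁻¹ = Ring.inverse`.  Junk map: `Z^{K,>} = 0` ⇒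
   `𝒢 = -log1p(-1) = 0` (empty truncated series; `constPart_effAction_eq_zero`), `𝒢₂ = 0`, `Z₂ = 1`, `η(trivial q) = 0`,
   `f = -(βL²)⁻¹ F_K` AT the point but `f → ∓∞` nearby in `h'`, `a`, `μ'` (isolated zeros) ⇒ `deriv = iteratedDeriv 2 = 0`
   ⇒ `(ρ_s, κ, m₀) = (0, 0, 0)`: fails `ρ_s.fst > 0`, harmless; NEAR (not at) a zero of `Z^{K,>}`: `m₀, ρ_s, κ` unbounded,
   but the coefficients of `𝒢 = -log1p(Z⁻¹B - 1)` grow like `Z^{-k}` ⇒ `η → ∞` ⇒ excluded by `etaStar`.  Zeros of `Z₂`: `η` blind to them ⇒ `m₀` unbounded with thresholds intact — needs `U ≠ 0` AND a non-empty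
   shell (at `U = 0`, `Z^{K,>}Z₂ = det(1 + C_K N_K) ≠ 0`, all factors `ω² + (…)² > 0`).  Not evaluable.
2. **Empty-shell frames** (§6): available at every `μ ∈ [-20-Λ₀, 12-Λ₀]` (mirror constant `4 + Λ₀ - μ` for the rest);
   `η = 0` for every `q`, so `etaStar` never binds; responses = true ones; R tautological there (factor-2 room,
   `c = 1`).  Consequence for the ROUTE (not a refutation): if d-wave order with positive stiffness holds at some
   `(U, μ)` (what [3] wants), the true-response datum is certified and thresholded with `fst ≈ OP`, and R returns
   `OP ≥ fst/2` — consistent.  Had the normalisation constant been `c > 2`, R would have contradicted [3]'s output;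
   `c = 1` checked against `partitionFn_dWaveSourceTorus_zero` (`E_k = √(ξ² + (h·dWaveSymbol)²)`).
3. **Flat-band frame** (§7): `K = ε` sits ON the boundary `coeffNorm 2 = 16`; at `μ = 0`, `e_K ≡ 0`, every momentum is
   below scale at low frequency, the Gaussian truncation runs over the whole zone.  At `U = 0` harmless (frame
   independence: the counterterm `𝒩'_K` re-inserts the band below scale); at `U ≠ 0` it is the most "junk-prone"
   admissible frame (flat free propagator `1/(iω - h'φσ₁)` of size `β` near the nodes of `φ`).  Nodal pins are dead there
   (`v_F = 0`), so only `Np = 0` or all-gapped data.  Not evaluable at `U ≠ 0`.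
4. **`μ` far outside the band** (`μ < -20 - Λ₀` or `μ > 20 + Λ₀`): EVERY admissible frame has an empty shell
   (`|K| ≤ 16`), so the whole CT report consists of true responses: `m₀ = O(h)` (vacuum / full band + pair source),
   `fst ≤ 0` — R true there non-vacuously iff `ρ_s` certifiable, which it is not (`ρ_s = O(h²)`): vacuous.
5. **`μ` moderately outside the band** (`-20 < μ < -4 - 2|U|`): frames CAN draw a fake Fermi curve
   (`K ≡ c ∈ (-4-μ, 4-μ)`), non-empty shell, `U ≠ 0` small: on paper the truncation re-inserts the band
   (`1 + C^≤(𝒩' + Σ) = C^≤(iω - H_true - Σ)` below scale) and `Σ` of the empty lattice is `O(U·n) ≈ 0` ⇒ `m₀ ≈` true `= O(h)`.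
   No uniform-in-`h` floor visible at any order in `U`.
6. **STANDING TARGET for later cycles / for anyone with a `U ≠ 0` evaluator**: exhibit `(U, μ)`, `Λ₀`, admissible
   `K_M` with non-empty shell such that `Z₂(h')` has a zero `h'_M(K) → h` from one side with `Z^{K,>}` bounded away
   from `0` (so `η` stays small) and `ρ_s κ ≥ (kStar Λ₀)²`; then `m₀ ≥ 2B_d + 1 > 2·dWaveOrderParameter` for all
   `(U, μ)` (`dWaveOrderParameter_le_const`) and R is refuted-SUBSTANTIVE (load-bearing claim "Gaussian truncation at
   scale bounds the order parameter" false as typed).  Conversely a proof of R must show `Z₂ ≠ 0` robustly — i.e. a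
   genuine stability statement about the quadratic truncation of the CT effective action in EVERY admissible frame.
7. **The frame freedom is policed by `η` (one loop, on paper).**  At `U = 0` in a frame `K` the CT effective
   action is the resummed counterterm `𝒢 = 𝒩'_K`, kernel `K(1 + w G_K K)⁻¹ = K(iω - e_K)/(iω - e_K + wK)` per Nambu
   mode; on the legs deep below scale (`w = 0`) it is the static `K(p)σ₃`, absorbed by `q.shift`; on the SOFT SHELL
   (`Λ₀²/4 < ω² + e_K² < Λ₀²`, `0 < w < 1`) the residue `R₂ = 𝒩' - K = -wK²/(iω - e_K + wK)` is genuinely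
   non-polynomial in `ω` (through `w(ω)`), so no `(n, z, a)` absorbs it: with the tree's normalisation
   (`weightedKernel = ε⁻²·kernel`, `legKernelNorm₂ = sup_k (1-w_k)|R₂(k)|/2`, weight `Λ₀^{-(4-3)}`)
   `η ≥ η₂ ≈ sup_shell (1-w)|R₂|/(2Λ₀)`, which is `≈ |K|/(2Λ₀)·O(1)` for `|K| ≫ Λ₀` on the shell and `≈ K²/Λ₀²` for
   `|K| ≲ Λ₀`.  So `η ≤ etaStar` FORCES `|K - Σ_static| ≲ √etaStar · Λ₀` on the soft shell: only (Λ₀-)honest frames are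
   certifiable — EXCEPT when the soft shell is EMPTY (§6), where nothing is policed and the responses are true by
   accident.  E.g. the flat frame of §7 at `U = 0`, `μ = 0` has `η₂ ≈ 2/Λ₀`.  At small `U ≠ 0` the same with
   `Σ_static = U n/2 + O(U²)`; the bare forward/exchange vertex costs `η₄ = Λ₀⁻⁵‖R₄‖ = O(N(0)·U)` (four soft legs with
   momentum conservation: phase space `ε²·#k₂·#k₃ ~ N(0)Λ₀⁵`), so `etaStar` admits `U ≲ etaStar/N(0)` with the bare
   vertex unrenormalised.  And in an honest frame the truncated factor is protected:
   `det[(iω - e_Kσ₃ - hφσ₁) + (1-w)(nσ₃ + aσ₁ - iωz)] = -(ω²(1+(1-w)z)² + ẽ² + Δ̃²) ≠ 0` for real static `(n, a)` and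
   `z > -1`; zeros of `Z₂` need a non-normal-form quadratic residue comparable with `π/β` at the lowest frequency with
   the acausal sign — not produced at any finite order in `U` with a causal self-energy.  Net: every junk window found
   in cycles 1–2 is closed either by `η`, by frame-independence at `U = 0`, or by accidental honesty; what remains is
   the physical claim (mean-field-at-scale with small remainder and large stiffness ⇒ `OP ≥ m₀/2`), for which no
   counterexample mechanism is visible and no proof exists in print.
8. Literature (cycle 2): SEARCH DEGRADED this cycle (local FTS index unavailable, OpenAlex / Semantic Scholar HTTP 429;
   Crossref only, query "finite-size criterion long-range order continuous symmetry ground state superfluid stiffness"):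
   no criterion of R's type (gapless `U(1)`, stiffness thresholds ⇒ order) and no counterexample pattern among the hits
   (nearest: Neves–Perez 1986, RP-based AF LRO; Kane–Kadanoff 1967); known neighbours remain Knabe 1988 /
   Gosset–Mozgunov 2016 (gap criteria), Koma–Tasaki 1994 (LRO ⇒ SSB, converse direction), KLS 1988 (RP).  To be redone
   with `lit galaxy search` when the services are back.  `ledger negatives`: unchanged (KlsOrderOpenness only).
9. Numerics (cycle 2): job j011801 (`free_bdg_responses.py`, μ = -1, L ≤ 1024, h ∈ [10⁻³, ½]) tabulates the free
   T = 0 BdG responses `m_L(h) = (1/L²)Σ hφ²/(2E)`, `κ`, `ρ_s = (2/L²)Σ cos p₁(1 - ξ/E)` — the U = 0 values of the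
   empty-shell / any-frame report — documenting `m ~ c·h log(1/h) → 0` and `κ, ρ_s = O(1) > 0` for `L ≫ 1/h`
   (results attached to the item as job evidence when it finishes). -/
theorem attacksOnPaperCycle2 : True := trivial

end

end Summit.HubbardSuperconductivity.HubbardSuperconductivity.Cruxes.AposterioriOrderCriterionR.Disproof
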